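import Mathlib
import HarnessLib

/-!
# Log-concave (`PF₂`) sequences on `ℕ`: the interval form, truncations, and closure under convolution

Elementary, division-free facts about nonnegative sequences `f : ℕ → ℝ` that are *log-concave without internal zeros*
(Pólya frequency sequences of order two, `PF₂`), stated in the INTERVAL form
`f a · f d ≤ f b · f c` whenever `a ≤ b ≤ d` and `a + d = b + c`
(equivalently: all `2 × 2` minors of the Toeplitz matrix `(f_{i−j})` are `≥ 0`; for positive sequences this is the usual
`f_n² ≥ f_{n−1} f_{n+1}`).  This is the hypothesis under which Efron's monotonicity theorem
(`EfronMonotonicity.lean`) holds, and the form in which it is used there.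

* `IsLogConcaveSeq f` — the predicate; `IsLogConcaveSeq.pos_of_mem_Icc` — no internal zeros;
* truncations to `{n < r}`, `{n ≤ r}`, `{r ≤ n}` stay log-concave; sequences supported in `{0, 1}` (Bernoulli weights) and
  `c·δ₀` are log-concave;
* `seqConv f g n = Σ_{k ≤ n} f k · g (n − k)` — convolution on `ℕ` (the law of a sum of independent `ℕ`-valued variables);
* **`isLogConcaveSeq_seqConv`** — `PF₂` is closed under convolution [Karlin 1968, Ch. 8 §1; classical, via the
  Cauchy–Binet expansion of the `2 × 2` Toeplitz minors of `T_{f⋆g} = T_f T_g`], proved here by the symmetrised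
  expansion `2·(h_b h_c − h_a h_d) = Σ_{k,l} [F(b−k)F(d−l) − F(b−l)F(d−k)]·[G(k)G(l−δ) − G(k−δ)G(l)]` (`δ = b − a`,
  `F, G` the extensions by `0` to `ℤ`), each term being a product of two factors of the same sign.

References: S. Karlin, *Total Positivity I* (1968), Ch. 8 §1 [Karlin1968]; B. Efron, Ann. Math. Statist. 36 (1965)
272–279 [Efron1965] (where `PF₂` closure under convolution is used for the `n`-variable induction).
Relation to the tree: `Literature.Analysis.TotalPositivity.IsMultiplyPositiveSeq 2` is the same class defined through
determinantal Toeplitz minors of order `≤ 2`; the present file is the minor-free working form needed for finite sums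
(no equivalence is proved here).
-/

namespace Literature.Probability.Distributions

open Finset

/-! ## The predicate -/

/-- A nonnegative sequence on `ℕ` that is **log-concave with no internal zeros** (`PF₂`), in interval form:
`f a · f d ≤ f b · f c` whenever `a ≤ b ≤ d` and `a + d = b + c`. [cite: Karlin1968, Ch. 8 §1] -/
def IsLogConcaveSeq (f : ℕ → ℝ) : Prop :=
  (∀ n, 0 ≤ f n) ∧ ∀ ⦃a b c d : ℕ⦄, a ≤ b → b ≤ d → a + d = b + c → f a * f d ≤ f b * f c

namespace IsLogConcaveSeq

variable {f g : ℕ → ℝ}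

/-- Terms of a `PF₂` sequence are nonnegative. [cite: Karlin1968, Ch. 8 §1] -/
theorem nonneg (hf : IsLogConcaveSeq f) (n : ℕ) : 0 ≤ f n := hf.1 n

/-- The interval inequality of a `PF₂` sequence. [cite: Karlin1968, Ch. 8 §1] -/
theorem mul_le_mul (hf : IsLogConcaveSeq f) {a b c d : ℕ} (hab : a ≤ b) (hbd : b ≤ d) (h : a + d = b + c) :
    f a * f d ≤ f b * f c := hf.2 hab hbd h

/-- The classical three-term form `f n · f (n+2) ≤ f (n+1)²`. [cite: Karlin1968, Ch. 8 §1] -/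
theorem mul_le_sq (hf : IsLogConcaveSeq f) (n : ℕ) : f n * f (n + 2) ≤ f (n + 1) * f (n + 1) :=
  hf.2 (by omega) (by omega) (by omega)

/-- **No internal zeros**: the support of a `PF₂` sequence is an interval. [cite: Karlin1968, Ch. 8 §1] -/
theorem pos_of_mem_Icc (hf : IsLogConcaveSeq f) {a b d : ℕ} (ha : 0 < f a) (hd : 0 < f d) (hab : a ≤ b) (hbd : b ≤ d) :
    0 < f b := by
  have h := hf.2 hab hbd (show a + d = b + (a + d - b) by omega)
  have hpos : 0 < f b * f (a + d - b) := lt_of_lt_of_le (mul_pos ha hd) h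
  rcases (hf.1 b).lt_or_eq with hb | hb
  · exact hb
  · rw [← hb, zero_mul] at hpos; exact absurd hpos (lt_irrefl 0)

/-- Truncation to `{n < r}` preserves `PF₂` (a `PF₂` sequence restricted to an interval is `PF₂`). [cite: Karlin1968, Ch. 8 §1] -/
theorem truncLT (hf : IsLogConcaveSeq f) (r : ℕ) : IsLogConcaveSeq (fun n => if n < r then f n else 0) := by
  refine ⟨fun n => by dsimp only; split_ifs <;> [exact hf.1 n; exact le_rfl], fun a b c d hab hbd h => ?_⟩
  dsimp only
  by_cases hd : d < r
  · have ha : a < r := by omega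
    have hb : b < r := by omega
    have hc : c < r := by omega
    simp only [ha, hb, hc, hd, if_true]; exact hf.2 hab hbd h
  · simp only [hd, if_false, mul_zero]
    exact mul_nonneg (by split_ifs <;> [exact hf.1 b; exact le_rfl]) (by split_ifs <;> [exact hf.1 c; exact le_rfl])

/-- Truncation to `{n ≤ r}` preserves `PF₂`. [cite: Karlin1968, Ch. 8 §1] -/
theorem truncLE (hf : IsLogConcaveSeq f) (r : ℕ) : IsLogConcaveSeq (fun n => if n ≤ r then f n else 0) := by
  have h := hf.truncLT (r + 1)
  refine ⟨fun n => ?_, fun a b c d hab hbd h' => ?_⟩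
  · have := h.1 n; dsimp only at this ⊢; simp only [Nat.lt_succ_iff] at this; exact this
  · have := h.2 hab hbd h'; dsimp only at this ⊢; simp only [Nat.lt_succ_iff] at this; exact this

/-- Truncation to `{r ≤ n}` preserves `PF₂`. [cite: Karlin1968, Ch. 8 §1] -/
theorem truncGE (hf : IsLogConcaveSeq f) (r : ℕ) : IsLogConcaveSeq (fun n => if r ≤ n then f n else 0) := by
  refine ⟨fun n => by dsimp only; split_ifs <;> [exact hf.1 n; exact le_rfl], fun a b c d hab hbd h => ?_⟩
  dsimp only
  by_cases ha : r ≤ a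
  · have hb : r ≤ b := by omega
    have hc : r ≤ c := by omega
    have hd : r ≤ d := by omega
    simp only [ha, hb, hc, hd, if_true]; exact hf.2 hab hbd h
  · simp only [ha, if_false, zero_mul]
    exact mul_nonneg (by split_ifs <;> [exact hf.1 b; exact le_rfl]) (by split_ifs <;> [exact hf.1 c; exact le_rfl])

/-- Scaling by a constant `c ≥ 0` preserves `PF₂`. [cite: Karlin1968, Ch. 8 §1] -/
theorem const_mul (hf : IsLogConcaveSeq f) {c : ℝ} (hc : 0 ≤ c) : IsLogConcaveSeq (fun n => c * f n) := by
  refine ⟨fun n => mul_nonneg hc (hf.1 n), fun a b c' d hab hbd h => ?_⟩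
  have := hf.2 hab hbd h
  calc c * f a * (c * f d) = c * c * (f a * f d) := by ring
    _ ≤ c * c * (f b * f c') := mul_le_mul_of_nonneg_left this (mul_nonneg hc hc)
    _ = c * f b * (c * f c') := by ring

end IsLogConcaveSeq

/-- A nonnegative sequence supported in `{0, 1}` (e.g. the weights `(1 − p, p)` of a Bernoulli variable) is `PF₂`. [cite: Karlin1968, Ch. 8 §1] -/
theorem isLogConcaveSeq_of_support_subset_zero_one {f : ℕ → ℝ} (h0 : ∀ n, 0 ≤ f n) (h2 : ∀ n, 2 ≤ n → f n = 0) :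
    IsLogConcaveSeq f := by
  refine ⟨h0, fun a b c d hab hbd h => ?_⟩
  by_cases hd : 2 ≤ d
  · rw [h2 d hd, mul_zero]; exact mul_nonneg (h0 b) (h0 c)
  · -- `d ≤ 1`: then `{a, d} = {b, c}` as multisets
    rcases Nat.eq_or_lt_of_le hab with rfl | hlt
    · obtain rfl : d = c := by omega
      exact le_rfl
    · obtain rfl : b = d := by omega
      obtain rfl : c = a := by omega
      rw [mul_comm]

/-- `c · δ₀` is `PF₂` for `c ≥ 0`. [cite: Karlin1968, Ch. 8 §1] -/
theorem isLogConcaveSeq_delta {c : ℝ} (hc : 0 ≤ c) : IsLogConcaveSeq (fun n => if n = 0 then c else 0) :=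
  isLogConcaveSeq_of_support_subset_zero_one (fun n => by split_ifs <;> [exact hc; exact le_rfl])
    (fun n hn => by rw [if_neg (by omega)])

/-! ## Convolution -/

/-- Convolution on `ℕ`: `(f ⋆ g)(n) = Σ_{k ≤ n} f k · g (n − k)` — the weights of `X + Y` for independent `ℕ`-valued `X ∼ f`,
`Y ∼ g` (composition of the Toeplitz matrices `T_f · T_g`). [cite: Karlin1968, Ch. 8 §1] -/
def seqConv (f g : ℕ → ℝ) (n : ℕ) : ℝ := ∑ k ∈ range (n + 1), f k * g (n - k)

/-- Unfolding `seqConv`. [cite: Karlin1968, Ch. 8 §1] -/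
theorem seqConv_def (f g : ℕ → ℝ) (n : ℕ) : seqConv f g n = ∑ k ∈ range (n + 1), f k * g (n - k) := rfl

/-- The reflected form `(f ⋆ g)(n) = Σ_{k ≤ n} f (n − k) · g k` (convolution is commutative). [cite: Karlin1968, Ch. 8 §1] -/
theorem seqConv_eq_sum_reflect (f g : ℕ → ℝ) (n : ℕ) : seqConv f g n = ∑ k ∈ range (n + 1), f (n - k) * g k := by
  rw [seqConv, ← sum_range_reflect]
  refine sum_congr rfl fun k hk => ?_
  have hk' := mem_range.1 hk
  rw [show n + 1 - 1 - k = n - k from by omega, show n - (n - k) = k from by omega]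

/-- The convolution of nonnegative sequences is nonnegative. [cite: Karlin1968, Ch. 8 §1] -/
theorem seqConv_nonneg {f g : ℕ → ℝ} (hf : ∀ n, 0 ≤ f n) (hg : ∀ n, 0 ≤ g n) (n : ℕ) : 0 ≤ seqConv f g n :=
  sum_nonneg fun k _ => mul_nonneg (hf k) (hg _)

/-- `δ₀ ⋆ g = g` (`T_δ₀` is the identity). [cite: Karlin1968, Ch. 8 §1] -/
theorem seqConv_delta_left (g : ℕ → ℝ) (n : ℕ) : seqConv (fun k => if k = 0 then (1 : ℝ) else 0) g n = g n := by
  rw [seqConv, sum_eq_single 0 (fun k _ hk => by rw [if_neg hk, zero_mul]) (fun h => absurd (mem_range.2 (by omega)) h)]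
  simp

/-! ### Extension by zero to `ℤ` (bookkeeping for the convolution theorem) -/

/-- Extension of a sequence on `ℕ` by `0` to `ℤ` (bookkeeping). [folklore] -/
private def zext (f : ℕ → ℝ) (n : ℤ) : ℝ := if 0 ≤ n then f n.toNat else 0

/-- On naturals `zext f` is `f`. [folklore] -/
@[simp] private theorem zext_natCast (f : ℕ → ℝ) (n : ℕ) : zext f n = f n := by
  simp [zext]

/-- Below `0` the extension vanishes. [folklore] -/
private theorem zext_of_neg (f : ℕ → ℝ) {n : ℤ} (hn : n < 0) : zext f n = 0 := by
  simp [zext, not_le.2 hn]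

/-- The extension of a nonnegative sequence is nonnegative. [folklore] -/
private theorem zext_nonneg {f : ℕ → ℝ} (hf : ∀ n, 0 ≤ f n) (n : ℤ) : 0 ≤ zext f n := by
  unfold zext; split_ifs <;> [exact hf _; exact le_rfl]

/-- The interval inequality for the extension by zero, with integer indices. [folklore] -/
private theorem IsLogConcaveSeq.zext_mul_le {f : ℕ → ℝ} (hf : IsLogConcaveSeq f) {a b c d : ℤ} (hab : a ≤ b) (hbd : b ≤ d)
    (h : a + d = b + c) : zext f a * zext f d ≤ zext f b * zext f c := by
  by_cases ha : 0 ≤ a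
  · have hb : 0 ≤ b := ha.trans hab
    have hc : 0 ≤ c := by linarith
    have hd : 0 ≤ d := hb.trans hbd
    obtain ⟨a', rfl⟩ := Int.eq_ofNat_of_zero_le ha
    obtain ⟨b', rfl⟩ := Int.eq_ofNat_of_zero_le hb
    obtain ⟨c', rfl⟩ := Int.eq_ofNat_of_zero_le hc
    obtain ⟨d', rfl⟩ := Int.eq_ofNat_of_zero_le hd
    simp only [zext_natCast]
    exact hf.2 (by exact_mod_cast hab) (by exact_mod_cast hbd) (by exact_mod_cast h)
  · rw [zext_of_neg f (not_le.1 ha), zero_mul]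
    exact mul_nonneg (zext_nonneg hf.1 b) (zext_nonneg hf.1 c)

/-- Shifted Toeplitz sums of the extensions compute the convolution:
`Σ_{k ≤ T} F(n + δ − k)·G(k − δ) = (f ⋆ g)(n)` whenever `n + δ ≤ T`. [folklore] -/
private theorem sum_zext_shift_eq_seqConv (f g : ℕ → ℝ) {n δ T : ℕ} (hT : n + δ ≤ T) :
    ∑ k ∈ range (T + 1), zext f ((n : ℤ) + δ - k) * zext g ((k : ℤ) - δ) = seqConv f g n := by
  rw [seqConv_eq_sum_reflect]
  -- the terms with `k < δ` or `k > n + δ` vanish; the others are `k = k' + δ`, `k' ≤ n`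
  have himg : (range (n + 1)).map (addRightEmbedding δ) ⊆ range (T + 1) := by
    intro k hk
    rw [mem_map] at hk
    obtain ⟨k', hk', rfl⟩ := hk
    rw [mem_range] at hk' ⊢
    simp only [addRightEmbedding_apply]; omega
  rw [← sum_subset himg]
  · rw [sum_map]
    refine sum_congr rfl fun k' hk' => ?_
    have hk'n := mem_range.1 hk'
    simp only [addRightEmbedding_apply, Nat.cast_add]
    rw [show (n : ℤ) + δ - (k' + δ) = ((n - k' : ℕ) : ℤ) from by push_cast [Nat.cast_sub (show k' ≤ n by omega)]; ring,
      show (k' : ℤ) + δ - δ = (k' : ℤ) from by ring, zext_natCast, zext_natCast]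
  · intro k hk hk'
    -- `k ∉ image`: either `k < δ` or `k > n + δ`
    by_cases h1 : (k : ℤ) - δ < 0
    · rw [zext_of_neg g h1, mul_zero]
    · have h2 : (n : ℤ) + δ - k < 0 := by
        by_contra h2
        apply hk'
        rw [mem_map]
        refine ⟨k - δ, mem_range.2 (by omega), ?_⟩
        simp only [addRightEmbedding_apply]
        omega
      rw [zext_of_neg f h2, zero_mul]

/-- **`PF₂` is closed under convolution.**  If `f` and `g` are log-concave without internal zeros, so is `f ⋆ g`
(classically: `T_{f⋆g} = T_f · T_g` and Cauchy–Binet for the `2 × 2` minors). [cite: Karlin1968, Ch. 8 §1] -/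
theorem isLogConcaveSeq_seqConv {f g : ℕ → ℝ} (hf : IsLogConcaveSeq f) (hg : IsLogConcaveSeq g) :
    IsLogConcaveSeq (seqConv f g) := by
  refine ⟨seqConv_nonneg hf.1 hg.1, fun a b c d hab hbd h => ?_⟩
  -- notation: `F, G` the extensions, `δ = b − a = d − c`, all Toeplitz sums over `k ≤ d`
  set F := zext f with hF
  set G := zext g with hG
  set δ : ℕ := b - a with hδ
  have hcd : c + δ = d := by omega
  have hδb : a + δ = b := by omega
  have eb : seqConv f g b = ∑ k ∈ range (d + 1), F ((b : ℤ) + (0 : ℕ) - k) * G ((k : ℤ) - (0 : ℕ)) :=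
    (sum_zext_shift_eq_seqConv f g (n := b) (δ := 0) (T := d) (by omega)).symm
  have ed : seqConv f g d = ∑ k ∈ range (d + 1), F ((d : ℤ) + (0 : ℕ) - k) * G ((k : ℤ) - (0 : ℕ)) :=
    (sum_zext_shift_eq_seqConv f g (n := d) (δ := 0) (T := d) (by omega)).symm
  have ec : seqConv f g c = ∑ k ∈ range (d + 1), F ((c : ℤ) + δ - k) * G ((k : ℤ) - δ) :=
    (sum_zext_shift_eq_seqConv f g (n := c) (δ := δ) (T := d) (by omega)).symm
  have ea : seqConv f g a = ∑ k ∈ range (d + 1), F ((a : ℤ) + δ - k) * G ((k : ℤ) - δ) :=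
    (sum_zext_shift_eq_seqConv f g (n := a) (δ := δ) (T := d) (by omega)).symm
  -- the antisymmetric kernels
  set Af : ℕ → ℕ → ℝ := fun k l => F ((b : ℤ) - k) * F ((d : ℤ) - l) - F ((b : ℤ) - l) * F ((d : ℤ) - k) with hAf
  set Dg : ℕ → ℕ → ℝ := fun k l => G (k : ℤ) * G ((l : ℤ) - δ) - G ((k : ℤ) - δ) * G (l : ℤ) with hDg
  -- (1) the symmetrised expansion: `diff = SP`, `SP = SQ` (swap `k ↔ l`), `SP + SQ = Σ Af·Dg`
  have e1 : seqConv f g b * seqConv f g c - seqConv f g a * seqConv f g d =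
      ∑ k ∈ range (d + 1), ∑ l ∈ range (d + 1), F ((b : ℤ) - k) * F ((d : ℤ) - l) * Dg k l := by
    rw [eb, ec, ea, ed, sum_mul_sum, sum_mul_sum, ← sum_sub_distrib]
    refine sum_congr rfl fun k _ => ?_
    rw [← sum_sub_distrib]
    refine sum_congr rfl fun l _ => ?_
    simp only [hDg, Nat.cast_zero, add_zero, sub_zero]
    rw [show (c : ℤ) + δ - l = (d : ℤ) - l from by rw [← hcd]; push_cast; ring,
      show (a : ℤ) + δ - k = (b : ℤ) - k from by rw [← hδb]; push_cast; ring]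
    ring
  have e2 : ∑ k ∈ range (d + 1), ∑ l ∈ range (d + 1), F ((b : ℤ) - k) * F ((d : ℤ) - l) * Dg k l =
      ∑ k ∈ range (d + 1), ∑ l ∈ range (d + 1), (- (F ((b : ℤ) - l) * F ((d : ℤ) - k) * Dg k l)) := by
    rw [sum_comm]
    refine sum_congr rfl fun k _ => sum_congr rfl fun l _ => ?_
    simp only [hDg]; ring
  have e3 : (∑ k ∈ range (d + 1), ∑ l ∈ range (d + 1), F ((b : ℤ) - k) * F ((d : ℤ) - l) * Dg k l) +
      ∑ k ∈ range (d + 1), ∑ l ∈ range (d + 1), (- (F ((b : ℤ) - l) * F ((d : ℤ) - k) * Dg k l)) =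
      ∑ k ∈ range (d + 1), ∑ l ∈ range (d + 1), Af k l * Dg k l := by
    rw [← sum_add_distrib]
    refine sum_congr rfl fun k _ => ?_
    rw [← sum_add_distrib]
    refine sum_congr rfl fun l _ => ?_
    simp only [hAf]; ring
  -- (2) termwise sign
  have hterm : ∀ k l : ℕ, 0 ≤ Af k l * Dg k l := by
    intro k l
    rcases le_total k l with hkl | hkl
    · refine mul_nonneg ?_ ?_
      · -- `F(b−l)F(d−k) ≤ F(b−k)F(d−l)`
        have := hf.zext_mul_le (a := (b : ℤ) - l) (b := (b : ℤ) - k) (c := (d : ℤ) - l) (d := (d : ℤ) - k)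
          (by omega) (by omega) (by ring)
        simp only [hAf]; linarith
      · -- `G(k−δ)G(l) ≤ G(k)G(l−δ)`
        have := hg.zext_mul_le (a := (k : ℤ) - δ) (b := (k : ℤ)) (c := (l : ℤ) - δ) (d := (l : ℤ))
          (by omega) (by exact_mod_cast hkl) (by ring)
        simp only [hDg]; linarith
    · -- both factors `≤ 0`
      have h1 : Af k l ≤ 0 := by
        have := hf.zext_mul_le (a := (b : ℤ) - k) (b := (b : ℤ) - l) (c := (d : ℤ) - k) (d := (d : ℤ) - l)
          (by omega) (by omega) (by ring)
        simp only [hAf]; linarith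
      have h2 : Dg k l ≤ 0 := by
        have := hg.zext_mul_le (a := (l : ℤ) - δ) (b := (l : ℤ)) (c := (k : ℤ) - δ) (d := (k : ℤ))
          (by omega) (by exact_mod_cast hkl) (by ring)
        simp only [hDg]; linarith
      exact mul_nonneg_of_nonpos_of_nonpos h1 h2
  have hsum : 0 ≤ ∑ k ∈ range (d + 1), ∑ l ∈ range (d + 1), Af k l * Dg k l :=
    sum_nonneg fun k _ => sum_nonneg fun l _ => hterm k l
  linarith [e1, e2, e3, hsum]

end Literature.Probability.Distributions
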